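import Summits.BirchSwinnertonDyer.BirchSwinnertonDyer.Theorems.GenusKolyvaginAtTwoPowDvdShaCardAtTwoRTRungFamilies
import HarnessLib

/-!
# Route `GenusKolyvaginAtTwo`, LINE 18 (L_T `PowDvdShaCardAtTwoRT`, stmt-BirchSwinnertonDyer-23242), stub L
# `stub_twinShaLaddersAtTwo` — ITS CONCLUSION, VERBATIM, FROM K-SIDE McCALLUM-SHAPED SUPPLIES AT EVERY RUNG

Seat `bsd-line-gk2-p2` g18 (PROVER seat 2/3, cell `bsd-f1-sign2`), `--supports stmt-BirchSwinnertonDyer-23242` (helper; closes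
nothing). THEOREMS ONLY (no definition, no named fact, no `sorry`); BSD is not proved by any of this.

WHAT. `twinShaLadders_of_Kside_supplies`: the ENTIRE conclusion of stub L (`∃ T M, antitone ∧ M 0 = M₀ ∧ M (2T) = 0 ∧ hfam ∧ hfam'`,
copied from the route file) from: a ladder `M` (for the consumer: Kolyvagin's running minima `M_r`, `M_{2T} = 0` from the bottom
rung), the frame over `K` at ONE level `2^L` (`W(ℚ)` `2^L`-divisible — rank `0`, odd torsion; `E(K)[2^L] = 0`; `Wd` any ℚ-model of
`W^{(d_K)}`; `g` generating `E(K)` mod `2^L`; `P₀ = P_1` with `2^L ∤ P₀`), and, per rung, the K-side avoidance supplies of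
`…RTRungFamilies` — (+) among FIXED Selmer classes of `H¹(K, E_K[2^L])` of order `2^{M_{2m} − M_{2m+1}}`, (−) among ANTI-FIXED Selmer
classes of order `2^{M_{2m+1} − M_{2m+2}}` with seed `⟨δ(P₀)⟩ = ⟨c_L(1)⟩`. So, by name, **stub L ⟸ (McCallum Prop. 5.2 over `K` at `2`
at every depth, signed) ∧ (bottom rung)**, the descent to `ℚ` and to the twin's model being kernel theorems.

References: [McCallumLMS1991] §5 Prop. 5.2, Thm. 5.4 (p. 310); [GrossLMS1991] §5 (5.1), Prop. 5.4; [Kolyvagin1991MathAnn] Thm. 1.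
-/

set_option autoImplicit false
-- the Theorems namespace of this sub repeats the summit name by design (D-0017 nested layout)
set_option linter.dupNamespace false

noncomputable section

open scoped Classical

namespace Summit.BirchSwinnertonDyer.BirchSwinnertonDyer.Theorems.GenusExact.PlusDescent

open WeierstrassCurve NumberField Field Literature.NumberTheory.EllipticCurves
  Literature.NumberTheory.GaloisRepresentations AddSubgroup

variable (W : WeierstrassCurve ℚ) [W.IsElliptic] (K : Type) [Field K] [NumberField K]
  (h2 : Module.finrank ℚ K = 2) (σ : K ≃ₐ[ℚ] K) (hσ : σ ≠ 1) (L : ℕ)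

include h2 hσ in
/-- **STUB L's CONCLUSION FROM K-SIDE SUPPLIES AT EVERY RUNG.** On the frame at level `2^L` over the quadratic field `K` (`σ ≠ 1`;
`W(ℚ)` `2^L`-divisible; `E(K)[2^L] = 0`; `Wd` a ℚ-model of `W^{(d_K)}`; `g` a generator of `E(K)` modulo `2^L`; `P₀ ∈ E(K)` with
`2^L ∤ P₀`), let `M` be an antitone ladder with `M 0 = M₀`, `M (2T) = 0`. If at every rung `m < T` the fixed Selmer classes of
`H¹(K, E_K[2^L])` of order `2^{M(2m) − M(2m+1)}` satisfy McCallum-shaped avoidance up to `2m+2` (binder `hsup`), and the anti-fixed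
ones of order `2^{M(2m+1) − M(2m+2)}` satisfy it with the seed `⟨δ(P₀)⟩` (binder `hsup'`), then the conclusion of
`stub_twinShaLaddersAtTwo` holds VERBATIM for `(W, K, M₀, Wd)`. [cite: McCallumLMS1991, §5 Prop. 5.2, Thm. 5.4 (p. 310)]
[cite: GrossLMS1991, §5 (5.1), Prop. 5.4] -/
theorem twinShaLadders_of_Kside_supplies
    (hdivQ : ∀ P : W.toAffine.Point, ∃ Q : W.toAffine.Point, ((2 ^ L : ℕ) : ℤ) • Q = P)
    (hdiv : ∀ P : geomPoints (W.baseChange K), ∃ Q : geomPoints (W.baseChange K), ((2 ^ L : ℕ) : ℤ) • Q = P)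
    (hL : ∀ P : (W.baseChange K).toAffine.Point, ((2 ^ L : ℕ) : ℤ) • P = 0 → P = 0)
    {Wd : WeierstrassCurve ℚ} (hWd : ∃ C : VariableChange ℚ, C • W.quadraticTwist (NumberField.discr K : ℚ) = Wd)
    (g : (W.baseChange K).toAffine.Point)
    (hg : ∀ P : (W.baseChange K).toAffine.Point, ∃ (k : ℤ) (Q : (W.baseChange K).toAffine.Point),
      ((2 ^ L : ℕ) : ℤ) • Q = P - k • g)
    (P₀ : (W.baseChange K).toAffine.Point) (hP₀ : ∀ Q : (W.baseChange K).toAffine.Point, ((2 ^ L : ℕ) : ℤ) • Q ≠ P₀)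
    (M₀ T : ℕ) (M : ℕ → ℕ) (hM : ∀ j, M (j + 1) ≤ M j) (hM0 : M 0 = M₀) (hMT : M (2 * T) = 0)
    (hsup : ∀ m < T, ∀ i < 2 * m + 2, ∀ u : Fin i → galH1Torsion (W.baseChange K) ((2 ^ L : ℕ) : ℤ),
      (∀ k, u k ∈ selmerGroup (W.baseChange K) ((2 ^ L : ℕ) : ℤ) ∧ conjAct W σ ((2 ^ L : ℕ) : ℤ) (u k) = u k) →
      (∀ k, addOrderOf (u k) = 2 ^ (M (2 * m) - M (2 * m + 1))) →
      ∃ y : galH1Torsion (W.baseChange K) ((2 ^ L : ℕ) : ℤ),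
        (y ∈ selmerGroup (W.baseChange K) ((2 ^ L : ℕ) : ℤ) ∧ conjAct W σ ((2 ^ L : ℕ) : ℤ) y = y) ∧
        addOrderOf y = 2 ^ (M (2 * m) - M (2 * m + 1)) ∧ Disjoint (zmultiples y) (AddSubgroup.closure (Set.range u)))
    (hsup' : ∀ m < T, ∀ i < 2 * m + 2, ∀ u : Fin i → galH1Torsion (W.baseChange K) ((2 ^ L : ℕ) : ℤ),
      (∀ k, u k ∈ selmerGroup (W.baseChange K) ((2 ^ L : ℕ) : ℤ) ∧ conjAct W σ ((2 ^ L : ℕ) : ℤ) (u k) = -u k) →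
      (∀ k, addOrderOf (u k) = 2 ^ (M (2 * m + 1) - M (2 * m + 2))) →
      ∃ y : galH1Torsion (W.baseChange K) ((2 ^ L : ℕ) : ℤ),
        (y ∈ selmerGroup (W.baseChange K) ((2 ^ L : ℕ) : ℤ) ∧ conjAct W σ ((2 ^ L : ℕ) : ℤ) y = -y) ∧
        addOrderOf y = 2 ^ (M (2 * m + 1) - M (2 * m + 2)) ∧
        Disjoint (zmultiples y) (AddSubgroup.closure (Set.range u) ⊔
          zmultiples (kummerMapTorsion (W.baseChange K) ((2 ^ L : ℕ) : ℤ) hdiv P₀))) :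
    ∃ (T : ℕ) (M : ℕ → ℕ), (∀ j, M (j + 1) ≤ M j) ∧ M 0 = M₀ ∧ M (2 * T) = 0 ∧
      (∀ m < T, ∃ x : Fin (2 * m + 2) → W.galH1, (∀ i, resBaseChange W K (x i) ∈ (W.baseChange K).sha) ∧
        (∀ i, addOrderOf (x i) = 2 ^ (M (2 * m) - M (2 * m + 1))) ∧
        ∀ c : Fin (2 * m + 2) → ℤ, ∑ i, c i • x i = 0 → ∀ i, ((2 ^ (M (2 * m) - M (2 * m + 1)) : ℕ) : ℤ) ∣ c i) ∧
      (∀ m < T, ∃ x : Fin (2 * m + 2) → Wd.galH1, (∀ i, resBaseChange Wd K (x i) ∈ (Wd.baseChange K).sha) ∧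
        (∀ i, addOrderOf (x i) = 2 ^ (M (2 * m + 1) - M (2 * m + 2))) ∧
        ∀ c : Fin (2 * m + 2) → ℤ, ∑ i, c i • x i = 0 → ∀ i, ((2 ^ (M (2 * m + 1) - M (2 * m + 2)) : ℕ) : ℤ) ∣ c i) := by
  have hn : ((2 ^ L : ℕ) : ℤ) ≠ 0 := by positivity
  refine ⟨T, M, hM, hM0, hMT, fun m hm ↦ ?_, fun m hm ↦ ?_⟩
  · exact exists_shaFamily_W_of_forall_exists_avoiding W K h2 σ hσ _ hn hdivQ hL (s := 2 * m + 2)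
      (a := M (2 * m) - M (2 * m + 1)) (hsup m hm)
  · exact exists_shaFamily_twin_of_forall_exists_avoiding W K h2 σ hσ L hdiv hL hWd g hg P₀ hP₀ (s := 2 * m + 2)
      (a := M (2 * m + 1) - M (2 * m + 2)) (hsup' m hm)

end Summit.BirchSwinnertonDyer.BirchSwinnertonDyer.Theorems.GenusExact.PlusDescent

end
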